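import Literature.Claims.NS.Zajaczkowski2023
import Literature.Analysis.FluidPDE.WholeSpaceIBP
import Summits.NavierStokesRegularity.NavierStokesRegularity.Theorems.RotatingEulerWindowProfileLinearRung
import HarnessLib

/-!
# C179 `Zajaczkowski2023` — kernel object: `¬ Step3_PlanItem3`
# (the columnar zero-flux pipe flow: a smooth solution of (3.1) that does not vanish on the axis)

`Literature.Claims.NS.Zajaczkowski2023.Step3_PlanItem3` types plan item 3, p.6 l.40–43 of arXiv:2304.00856v1
(«In Section 3 for a given ω₁ ∈ H¹(Ω) many estimates for ψ₁ are found. In Lemma 3.3 we derived such estimate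
that ψ₁ must vanish on the axis of symmetry. … The result of Lemma 3.3 shows that weak solutions proved in
Lemma 2.5 must vanish on the axis of symmetry»; cf. p.6 l.31 «To prove (1.24) we need that ψ₁ and v_z vanish on
the axis of symmetry») at function grain: for every cylinder `R, a > 0` and every pair of `C^∞` axisymmetric
`2a`-periodic scalar fields `ψ₁, ω₁` on `ℝ³` with `ψ₁|_{r=R} = 0` solving (3.1) = (1.22)
`−Δψ₁ − (2/r)ψ_{1,r} = ω₁` off the axis (`SolvesStream R a ψ₁ ω₁`), `ψ₁` vanishes on the axis `{r = 0}`.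
CONSUMED binder 2 of `claim_of_steps` (it upgrades every solution to the hypothesis of Lemma 3.3, p.17 l.26–27
«Let ψ₁ be such weak solution to problem (3.1) that it vanishes on the axis of symmetry»).

It is false (the print says as much: Remark 2.6 p.10 l.64–65 «the weak solution ψ₁ of (1.22) does not vanish
on the axis of symmetry», Remark 3.4 p.18 l.53–55). WITNESS (R = a = 1; W4 columnar pipe-flow family, zero
axial flux): with `ρ = x₀² + x₁² = r²`,
  `ψ₁ = 1 − (3/2)ρ + ρ²/2`,  `ω₁ = 12 − 12ρ`.
Both are polynomials in `ρ` (smooth, axisymmetric, independent of `x₂` hence `2`-periodic), `ψ₁ = 0` on `{r = 1}`,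
`Δψ₁ = 8ρ − 6`, `ψ_{1,r} = (2ρ − 3)r`, so `−Δψ₁ − (2/r)ψ_{1,r} = 6 − 8ρ + 6 − 4ρ = 12 − 12ρ = ω₁` at every point off
the axis; and `ψ₁ = 1 ≠ 0` on the axis. (This `ψ₁ = ψ/r` is the stream variable of the z-independent
zero-flux axial flow `v = (2 − 6r² + 3r⁴) ē_z` in the unit pipe — `v_r = v_φ = 0`, `ω_φ = 12r(1 − r²) = 0` on the
wall, `v_z|_{r=0} = 2ψ₁|_{r=0} = 2` — a steady solution of (1.6) with force `f = 24ν(1 − 2r²)ē_z`; the present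
file needs only the elliptic pair.)

Main results (namespace `Summit.NavierStokesRegularity.NavierStokesRegularity.Theorems.Zajaczkowski2023Columnar`,
new): `rho`, `psiW`, `omW`, `hasFDerivAt_rho`, `hasFDerivAt_psiW`, `contDiff_psiW`, `contDiff_omW`,
`laplacian_psiW`, `dR_psiW`, `solvesStream_psiW`, `not_Step3_PlanItem3`.

WHAT THIS IS NOT: not a claim about NS regularity or blow-up; not a claim about any author beyond the typed
locator [cite: Zajaczkowski2023, plan item 3 p.6 l.40–43; Lemma 3.3 p.17 l.26–27; Remark 2.6 p.10 l.64–65].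
-/

noncomputable section

set_option linter.dupNamespace false

open Set Function WithLp
open scoped ContDiff Laplacian InnerProductSpace RealInnerProductSpace

namespace Summit.NavierStokesRegularity.NavierStokesRegularity.Theorems.Zajaczkowski2023Columnar

open Summit.NavierStokesRegularity.NavierStokesRegularity.Theorems.RotatingEulerWindowProfileLinearRung (hasFDerivAt_coord)

open Literature.Analysis.FluidPDE Literature.Claims.NS.Zajaczkowski2023

/-! ## Coordinate calculus on `ℝ³` -/

-- `hasFDerivAt_coord` is the landed `…Theorems.RotatingEulerWindowProfileLinearRung.hasFDerivAt_coord` (gate dedup).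

/-- The coordinates are smooth. [folklore] -/
theorem contDiff_coord {n : WithTop ℕ∞} (j : Fin 3) : ContDiff ℝ n (fun y : E3 => y j) :=
  (EuclideanSpace.proj j : E3 →L[ℝ] ℝ).contDiff

/-! ## The witness: `ρ = x₀² + x₁²`, `ψ₁ = 1 − (3/2)ρ + ρ²/2`, `ω₁ = 12 − 12ρ` -/

/-- `ρ = x₀² + x₁² = r²` (squared distance to the axis). [folklore] -/
def rho (y : E3) : ℝ := y 0 * y 0 + y 1 * y 1

/-- The witness stream variable `ψ₁ = 1 − (3/2)ρ + ρ²/2` (`= ψ/r` of the zero-flux pipe flow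
`v_z = 2 − 6r² + 3r⁴`). [cite: Zajaczkowski2023, (1.21)–(1.22) p.5] -/
def psiW (y : E3) : ℝ := 1 - 3 / 2 * rho y + 1 / 2 * (rho y * rho y)

/-- The witness datum `ω₁ = 12 − 12ρ` (`= ω_φ/r`, `ω_φ = 12r(1 − r²)`). [cite: Zajaczkowski2023, (1.23) p.5] -/
def omW (y : E3) : ℝ := 12 - 12 * rho y

/-- `ρ = r²`. [folklore] -/
theorem rho_eq_cylRadius_sq (y : E3) : rho y = cylRadius y ^ 2 := by
  rw [cylRadius_sq]; unfold rho; ring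

/-- `Dρ(x) = 2x₀ dx₀ + 2x₁ dx₁`. [folklore] -/
theorem hasFDerivAt_rho (x : E3) :
    HasFDerivAt rho ((2 * x 0) • (EuclideanSpace.proj (0 : Fin 3) : E3 →L[ℝ] ℝ) +
      (2 * x 1) • (EuclideanSpace.proj (1 : Fin 3) : E3 →L[ℝ] ℝ)) x := by
  have h := ((hasFDerivAt_coord 0 x).mul (hasFDerivAt_coord 0 x)).add
    ((hasFDerivAt_coord 1 x).mul (hasFDerivAt_coord 1 x))
  refine h.congr_fderiv ?_
  ext w
  simp
  ring

/-- `ρ` is smooth. [folklore] -/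
theorem contDiff_rho {n : WithTop ℕ∞} : ContDiff ℝ n rho :=
  ((contDiff_coord 0).mul (contDiff_coord 0)).add ((contDiff_coord 1).mul (contDiff_coord 1))

/-- `ψ₁` is smooth. [folklore] -/
theorem contDiff_psiW {n : WithTop ℕ∞} : ContDiff ℝ n psiW :=
  (contDiff_const.sub (contDiff_const.mul contDiff_rho)).add (contDiff_const.mul (contDiff_rho.mul contDiff_rho))

/-- `ω₁` is smooth. [folklore] -/
theorem contDiff_omW {n : WithTop ℕ∞} : ContDiff ℝ n omW :=
  contDiff_const.sub (contDiff_const.mul contDiff_rho)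

/-- The coefficient `s = 2ρ − 3` of the gradient `∇ψ₁ = s · (x₀, x₁, 0)`. [folklore] -/
def sW (y : E3) : ℝ := 2 * rho y - 3

/-- `Dψ₁(x) = s(x) (x₀ dx₀ + x₁ dx₁)`, `s = 2ρ − 3`. [folklore] -/
theorem hasFDerivAt_psiW (x : E3) :
    HasFDerivAt psiW ((sW x * x 0) • (EuclideanSpace.proj (0 : Fin 3) : E3 →L[ℝ] ℝ) +
      (sW x * x 1) • (EuclideanSpace.proj (1 : Fin 3) : E3 →L[ℝ] ℝ)) x := by
  have hρ := hasFDerivAt_rho x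
  have hρρ : HasFDerivAt (fun y : E3 => rho y * rho y)
      (rho x • ((2 * x 0) • (EuclideanSpace.proj (0 : Fin 3) : E3 →L[ℝ] ℝ) +
        (2 * x 1) • (EuclideanSpace.proj (1 : Fin 3) : E3 →L[ℝ] ℝ)) +
        rho x • ((2 * x 0) • (EuclideanSpace.proj (0 : Fin 3) : E3 →L[ℝ] ℝ) +
        (2 * x 1) • (EuclideanSpace.proj (1 : Fin 3) : E3 →L[ℝ] ℝ))) x := hρ.mul hρ
  have h : HasFDerivAt (fun y : E3 => 1 - 3 / 2 * rho y + 1 / 2 * (rho y * rho y)) _ x :=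
    ((hasFDerivAt_const (1 : ℝ) x).sub (hρ.const_mul (3 / 2))).add (hρρ.const_mul (1 / 2))
  refine h.congr_fderiv ?_
  ext w
  simp [sW]
  ring

/-- `Dψ₁(x) w = s(x) (x₀ w₀ + x₁ w₁)`. [folklore] -/
theorem fderiv_psiW_apply (x w : E3) :
    fderiv ℝ psiW x w = sW x * x 0 * w 0 + sW x * x 1 * w 1 := by
  rw [(hasFDerivAt_psiW x).fderiv]
  simp

/-- `Ds(x) = 4x₀ dx₀ + 4x₁ dx₁`. [folklore] -/
theorem hasFDerivAt_sW (x : E3) :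
    HasFDerivAt sW ((4 * x 0) • (EuclideanSpace.proj (0 : Fin 3) : E3 →L[ℝ] ℝ) +
      (4 * x 1) • (EuclideanSpace.proj (1 : Fin 3) : E3 →L[ℝ] ℝ)) x := by
  have h : HasFDerivAt (fun y : E3 => 2 * rho y - 3) _ x := ((hasFDerivAt_rho x).const_mul 2).sub_const 3
  refine h.congr_fderiv ?_
  ext w
  simp
  ring

/-- The pure second partials: `∂_j (s x_j) = 4x_j² + s` for `j = 0, 1`. [folklore] -/
theorem fderiv_grad_comp (j : Fin 3) (hj : j = 0 ∨ j = 1) (x : E3) :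
    fderiv ℝ (fun y : E3 => sW y * y j) x (EuclideanSpace.single j (1 : ℝ)) = 4 * x j * x j + sW x := by
  have h : HasFDerivAt (fun y : E3 => sW y * y j) _ x := (hasFDerivAt_sW x).mul (hasFDerivAt_coord j x)
  rw [h.fderiv]
  rcases hj with rfl | rfl <;> simp <;> ring

/-- **`Δψ₁ = 8ρ − 6`.** [folklore] -/
theorem laplacian_psiW (x : E3) : (Δ psiW) x = 8 * rho x - 6 := by
  rw [laplacian_eq_sum_fderiv_fderiv (EuclideanSpace.basisFun (Fin 3) ℝ) (contDiff_psiW (n := 2)) x,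
    Fin.sum_univ_three]
  have e0 : (fun y => fderiv ℝ psiW y ((EuclideanSpace.basisFun (Fin 3) ℝ) 0)) = fun y => sW y * y 0 := by
    funext y; rw [fderiv_psiW_apply]; simp
  have e1 : (fun y => fderiv ℝ psiW y ((EuclideanSpace.basisFun (Fin 3) ℝ) 1)) = fun y => sW y * y 1 := by
    funext y; rw [fderiv_psiW_apply]; simp
  have e2 : (fun y => fderiv ℝ psiW y ((EuclideanSpace.basisFun (Fin 3) ℝ) 2)) = fun _ => (0 : ℝ) := by
    funext y; rw [fderiv_psiW_apply]; simp
  have z2 : fderiv ℝ (fun _ : E3 => (0 : ℝ)) x ((EuclideanSpace.basisFun (Fin 3) ℝ) 2) = 0 := by simp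
  rw [e0, e1, e2, z2]
  simp only [EuclideanSpace.basisFun_apply]
  rw [fderiv_grad_comp 0 (Or.inl rfl) x, fderiv_grad_comp 1 (Or.inr rfl) x]
  unfold sW rho
  ring

/-- **`ψ_{1,r} = s r = (2ρ − 3) r`** off the axis (the skeleton's `dR ψ₁ = Dψ₁[e_r]`). [folklore] -/
theorem dR_psiW {x : E3} (hx : cylRadius x ≠ 0) : dR psiW x = sW x * cylRadius x := by
  unfold dR
  rw [fderiv_psiW_apply]
  have hr2 : cylRadius x ^ 2 = x 0 ^ 2 + x 1 ^ 2 := cylRadius_sq x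
  have e0 : eR x 0 = (cylRadius x)⁻¹ * x 0 := by simp [eR]
  have e1 : eR x 1 = (cylRadius x)⁻¹ * x 1 := by simp [eR]
  rw [e0, e1]
  calc sW x * x 0 * ((cylRadius x)⁻¹ * x 0) + sW x * x 1 * ((cylRadius x)⁻¹ * x 1)
        = sW x * (cylRadius x)⁻¹ * (x 0 ^ 2 + x 1 ^ 2) := by ring
    _ = sW x * ((cylRadius x)⁻¹ * cylRadius x) * cylRadius x := by rw [← hr2]; ring
    _ = sW x * cylRadius x := by rw [inv_mul_cancel₀ hx]; ring

/-- `ψ₁` is axisymmetric (a function of `ρ = r²`). [folklore] -/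
theorem isAxisymmetricScalar_psiW : IsAxisymmetricScalar psiW := by
  intro θ x
  have h : rho (rotZ θ x) = rho x := by
    rw [rho_eq_cylRadius_sq, rho_eq_cylRadius_sq, cylRadius_rotZ]
  unfold psiW
  rw [h]

/-- `ω₁` is axisymmetric. [folklore] -/
theorem isAxisymmetricScalar_omW : IsAxisymmetricScalar omW := by
  intro θ x
  have h : rho (rotZ θ x) = rho x := by
    rw [rho_eq_cylRadius_sq, rho_eq_cylRadius_sq, cylRadius_rotZ]
  unfold omW
  rw [h]

/-- `ρ` does not see translations along the axis. [folklore] -/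
theorem rho_add_axial (L : ℝ) (x : E3) : rho (x + L • EuclideanSpace.single (2 : Fin 3) (1 : ℝ)) = rho x := by
  unfold rho
  simp

/-- `ψ₁` is `L`-periodic in `x₂` for every `L` (it does not depend on `x₂`). [folklore] -/
theorem isAxiallyPeriodic_psiW (L : ℝ) : IsAxiallyPeriodic L psiW := by
  intro x; unfold psiW; rw [rho_add_axial]

/-- `ω₁` is `L`-periodic in `x₂` for every `L`. [folklore] -/
theorem isAxiallyPeriodic_omW (L : ℝ) : IsAxiallyPeriodic L omW := by
  intro x; unfold omW; rw [rho_add_axial]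

/-- `ψ₁ = 0` on the wall `{r = 1}`. [folklore] -/
theorem psiW_wall {x : E3} (hx : cylRadius x = 1) : psiW x = 0 := by
  have h : rho x = 1 := by rw [rho_eq_cylRadius_sq, hx]; norm_num
  unfold psiW; rw [h]; norm_num

/-- **The witness solves (3.1) = (1.22) off the axis: `−Δψ₁ − (2/r)ψ_{1,r} = ω₁`.** [cite: Zajaczkowski2023, (3.1) p.11 l.97–104] -/
theorem omega1Of_psiW {x : E3} (hx : cylRadius x ≠ 0) : omega1Of psiW x = omW x := by
  unfold omega1Of
  rw [laplacian_psiW, dR_psiW hx]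
  unfold omW sW
  field_simp
  ring

/-- **`SolvesStream 1 1 ψ₁ ω₁`**: the witness pair is an admissible (smooth, axisymmetric, `2`-periodic,
`ψ₁|_{r=1} = 0`) solution of (3.1) in the unit cylinder. [cite: Zajaczkowski2023, (3.1) p.11 l.97–104; Lemma 2.5 p.10 l.43–47] -/
theorem solvesStream_psiW : SolvesStream 1 1 psiW omW :=
  ⟨contDiff_psiW, contDiff_omW, isAxisymmetricScalar_psiW, isAxisymmetricScalar_omW,
    isAxiallyPeriodic_psiW _, isAxiallyPeriodic_omW _, fun _ hx => psiW_wall hx,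
    fun _ _ hx => omega1Of_psiW hx⟩

/-- `ψ₁ = 1` on the axis. [folklore] -/
theorem psiW_axisPt (z : ℝ) : psiW (axisPt z) = 1 := by
  unfold psiW rho axisPt pt
  simp

/-- **C179 head candidate — `¬ Step3_PlanItem3`** (plan item 3 p.6 l.40–43, function grain; CONSUMED binder 2
of `claim_of_steps`): the smooth axisymmetric zero-flux pair `ψ₁ = 1 − (3/2)r² + r⁴/2`, `ω₁ = 12(1 − r²)` solves
(3.1) in the unit periodic cylinder with `ψ₁|_{r=1} = 0`, yet `ψ₁|_{r=0} = 1 ≠ 0`.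
Class: false lemma (countermodel). [cite: Zajaczkowski2023, plan item 3 p.6 l.40–43; Remark 2.6 p.10 l.64–65; Lemma 3.3 p.17 l.26–27; Remark 3.4 p.18 l.53–55] -/
theorem not_Step3_PlanItem3 : ¬ Step3_PlanItem3 := by
  intro h
  have h0 := h 1 1 one_pos one_pos psiW omW solvesStream_psiW 0
  rw [psiW_axisPt] at h0
  exact one_ne_zero h0

end Summit.NavierStokesRegularity.NavierStokesRegularity.Theorems.Zajaczkowski2023Columnar

end

-- WHAT THIS IS NOT: not a claim about NS regularity or blow-up; not a claim about any author beyond the typed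
-- locator.
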